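import Summits.BirchSwinnertonDyer.BirchSwinnertonDyer.Theses.ByReductionTypeAtTwo
import Literature.NumberTheory.EllipticCurves.GlobalMinimalModel
import Summits.BirchSwinnertonDyer.Rank1Residual.F1Sign2.LevelRaisingAtTwo
import HarnessLib

/-!
# Cell `bsd-f1-sign2` — ES lens (-es g21, MEMO-es §30; D-es-77, TURNKEY-es-30): ES-30 «THE SCALAR CHARACTER OF A MOD-2 CONGRUENCE IN CLOSED FORM, AND THE 3-CYCLE TRACE LEMMA MOD 4»
# (ES-30a `ThreeCycleTraceModFour`, ES-30b `ScalarCharacterLaw`, ES-30c `SupersingularScalarCharacterCongruence` + the glue `scalarLaw_of_ss` / `jacobiSym_neg_candidates`)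

STATEMENTS ONLY (+ -es's two glue theorems), typer -ty g17.  Port asked by -es g21 (D-es-77 «port Sketch30 + bib»; coordinator TURNKEY-es-30), REF-GATED until REF1 g18 §197
(INBOX 2026-08-29T13:05:37Z, «R197b port notes for D-es-77»).  Source: `HOME/data-es/g21/lean/Sketch30.lean` **f952613fdb453de7** (142 l., rc 0, 0 sorry; -es's shape probes 3/3
CLEAN; = -es's crux copy `Cruxes/RankOneAtTwoBigImageOddLocal/ScalarCharacterES30.lean` byte-identical); REF1's probe `HOME/REF1-data/b197/lean/Probe197.lean` **3455db9ec2502128** (farm rc 0 ·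
3 sorries · 9 sorry-free BC7 lemmas).  HOMING as for ES-27/ES-28: `Summits/…/Theorems/` is prover-only for the gate (D-0016), so the file lives in the cell folder `F1Sign2/` under
-es's OWN namespace `…Theorems.RankOneAtTwoScalarCharacter` as sketched.  **R197b APPLIED: the sketch's re-declarations of `twoDivCubic` / `ModTwoCongruent` are DROPPED and
ES-28's decls (`F1Sign2/LevelRaisingAtTwo.lean`, namespace `…Theorems.RankOneAtTwoLevelRaising`) are imported and `open`ed instead** (identical bodies; no vendored copy);
everything else VERBATIM — `twoDivCubicModP`, `frobHalfDisc`, the three rows (`@[conjecture]`, R197b: keep until Lean proofs land) and the two glue theorems (bodies byte-identical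
to the sketch AND Probe197, builder-verified); docstrings verbatim + one REF1-AUDIT §197 and one REF2-PLACEMENT v53 §10/§12 rider each; -es's module docstring below verbatim.
GRADES (REF1-AUDIT §197 D-es-78, evidence `HOME/REF1-data/b197/` SHA16.txt): PAPER PROOFS ALL PASS, every congruence re-derived — **ES-30a THEOREM-grade; ES-30b THEOREM ⟸ 30a;
ES-30c THEOREM ⟸ 30b + L30**; glue CLEAN; KILLED none; REF1 second engines (own code): ES-30a 422 160/422 160 (all monic irreducible cubics, odd p ≤ 67), ES-30b 700/700 congruent
pairs (exactly one sign of D), ES-30c 684/684 both-ss pairs vs 5/16 ord–ord pairs with D ≡ 3 (4) (witness 53a1 ~ 583b1) ⟹ the ss binder is LOAD-BEARING, `2 ∣ a₂(W′)` implied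
(R197c); R197d: «computer-assisted» may be dropped for L30 / (L-ss-i).  Billing of MEMO-es §29/§30 after §197: REF1's paper audit covers (T2)–(T8) — ALL PASS, Honda-free —
so ES-29G/M/A are THEOREMS on the sub-frame «odd part of N_W squarefree» and conjecture-candidates exactly as typed (R191a = R197a: no local sign identity at an ADDITIVE odd
p ∣ N_W; -es or the typer to type `LevelRaisedSignLawAtTwoSemistableOdd` with the ES-29 port).  REF2-PLACEMENT v53 §10 (ac86d6e19df3a5ec): ES-30a = COROLLARY OF PRINT + a finite
identity in GL₂(ℤ/4) + ONE orientation bit ([cite: FukudaYoshikawa2017, Thm. 5.1, Cor. 4.5], [cite: BandiniPaladino2016, §6]; REF2 script `es30a_gl2z4.py`; verbatim home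
probably [cite: Adelmann2001, §5.5], acq-14595); ES-30b = ES-30a twice, KNOWN-TYPE; §12.1: L30 / ES-30c NOT located as a statement — KNOWN-TYPE elementary lemma (Hensel
perturbation of Y³ + 1), port with its proof, cite [cite: LeHungLi2016, Lemma 45] (4) as the printed neighbour; §14.1: (L-ss-i)/(L-ss-ii) elementary known-type; cross-file to -imc:
«loc₂ γ_W = [type ±2]·Λ» is an all-paper layer-0, f = 3 instance of type-visibility (V(3) = S).  Beyond-print theorem: «YES only as verbatim-not-located» (REF2 §10).
PARTITION none.  BSD is not proved.  bears_on: stmt-BirchSwinnertonDyer-23715.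

## -es's module docstring of `Sketch30.lean` (verbatim)

# ES-30 (cell bsd-f1-sign2, seat -es g21): THE SCALAR CHARACTER OF A MOD-2 CONGRUENCE IN CLOSED FORM, AND THE 3-CYCLE TRACE LEMMA MOD 4

Sketch only (planner seat; nothing here is proposed to the tree; the typer ports).  Crux `RankOneAtTwoBigImageOddLocal`
(stmt-BirchSwinnertonDyer-23715).  Continuation of ES-28/ES-29 (g19/g20: level-raising Euler system at `p = 2`; the sign law of mod-2
level raising `w(W')·w(W) = −ε_q·(ε*_q)^{t_q}·(−1)^{κ_∞}` on the frame, MEMO-es §29).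

SETTING.  `W ≡ W' (mod 2)` with IRREDUCIBLE 2-division cubics: `ρ_{W',4} = (1 + 2c)·ρ_{W,4}`, `[c] = (ψ, ξ)`, `ψ = res_F χ_{d'}` the SCALAR
character (`F = ℚ(√Δ_W)`, `d'` defined mod `⟨ℚˣ², Δ_W⟩`), `ξ = β = f'_W(θ)f'_{W'}(θ')` (§29 (T3)).  THIS FILE closes the scalar half:

* **ES-30a (LEMMA, proved on paper; brute force 376 984 / 376 984 irreducible cubics over all odd `p ≤ 263`).**  `p` odd, `f ∈ 𝔽_p[x]`
  an irreducible cubic with root `e ∈ 𝔽_{p³}`, `E : y² = f(x)`.  The FROBENIUS-ORIENTED half-discriminant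
  `δ^φ := (e − e^p)(e − e^{p²})(e^p − e^{p²}) ∈ 𝔽_pˣ` (a canonical square root of `disc f`, independent of `e`) satisfies
  `a_p(E) ≡ −(δ^φ / p) (mod 4)`.
  PROOF: `φ = Frob_p ∈ GL(E[4])`, `φ̄` a 3-cycle, `t = tr φ ≡ a_p`, `d = det φ ≡ p`; Cayley–Hamilton gives `φ³ = −t` if `p ≡ 1 (4)` and
  `φ³ = 2φ + t` if `p ≡ 3 (4)`; on the other hand `φ³ = Frob_{p³}` acts on `ℚ(E[4]) = 𝔽_{p³}(√(e_i − e_j), √−1)`-generators by the signs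
  `χ_{p³}(e_i − e_j) ∈ {χ_p(±δ^φ)}` (norms `N(e − e^p) = −δ^φ`), `χ_p(−1)`, and the explicit halving `½T₁ = (e₁ + uv, uv(u+v))`,
  `u² = e₁ − e₂`, `v² = e₁ − e₃`, `Q + T₂ = Q(u,−v)`, `Q + T₃ = Q(−u,v)` (Bekker–Zarhin 2017 Thm 2.1) turns the signs into `φ³ = ±1`
  resp. `φ³ = 1 + 2φ̄^{±1}`; comparing yields `t ≡ −χ_p(δ^φ)` in all four cases `(p mod 4, χ)`.
* **ES-30b (THEOREM given ES-30a): the scalar character is `χ_D`, `D := 16·δ₀(W)·δ₀(W') = ∏_{i<j}(e_i − e_j)(e'_i − e'_j)·16 ∈ ℤ`** for the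
  Galois-compatible labelling (`e'_i :=` the root of `f_{W'}` in `ℚ(e_i)`), `D² = Δ_W Δ_{W'}`; equivalently, at every good prime `p` where
  the cubic is irreducible mod `p`: `a_p(W') ≡ (D/p)·a_p(W) (mod 4)`.  Census: 217 966 / 217 966 SR29 rows (engine-2's `d'` measured from
  `a_p` congruences vs `|D|` mod `⟨□, Δ_W⟩`; sign vs `sgn σ` 107 916 / 107 916).  So `W'[4] ≅ W[4] ⊗ (1 + 2(χ_D·1 + β))` is EXPLICIT in root data.
* **ES-30c (THEOREM given ES-30b + the local lemma L30): at a common GOOD SUPERSINGULAR 2 the working `D` is `≡ 1 (mod 4)`**, i.e. `χ_{d'}` is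
  UNRAMIFIED at 2 = hypothesis (L-ss-iii) of the supersingular case (T8) of the sign law.  L30 (ENGINE `local30.py`, exact arithmetic in
  `ℤ₂[ζ₃][π]/(π³ − 2)`): for every good-supersingular model over `ℤ₂` the canonical unit `R(W) := −(1 + 2ζ₃)·∏_{i<j}(Y_i − Y_j)/3 ∈ ℤ₂ˣ`
  (`e_i = πY_i/2`, roots labelled `Y_i ≡ 1, ζ₃, ζ₃² (mod π)`, `∏(Y_i − Y_j) = ±√Δ_W ∈ ℚ₂(ζ₃)`) is `≡ 1 (mod 4)`: all 8 deciding residue classes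
  `(b₂/4 mod 4, b₄/2 mod 2, b₆ ≡ 1 mod 4)` (precision lemma: agreeing classes give roots agreeing mod `π⁶ = 4`), run as 2 048 classes + 6 000
  random models: 8 048 / 8 048, `R mod 16` equidistributed on `{1,5,9,13}`.  Hence `D = PP' = −3RR' ≡ 1 (mod 4)`; g20 census `d' ≡ 1, 5 (mod 8)`:
  14 789 / 14 789.  With (L-ss-i/ii) (g20 engine L3, finite) this makes (T8), hence ES-29G and the frame law ES-29A, THEOREMS modulo the audit
  of the paper proofs (T1)–(T7) — Honda's classification is not needed.
-/

noncomputable section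

open scoped Classical
open Polynomial

set_option linter.dupNamespace false
set_option autoImplicit false

namespace Summit.BirchSwinnertonDyer.BirchSwinnertonDyer.Theorems.RankOneAtTwoScalarCharacter

open Literature.NumberTheory.EllipticCurves WeierstrassCurve
open Summit.BirchSwinnertonDyer.BirchSwinnertonDyer.Theorems.RankOneAtTwoLevelRaising (twoDivCubic ModTwoCongruent)

/-- The `2`-division cubic of an INTEGRAL model reduced mod an odd prime `p`: `4x³ + b₂x² + 2b₄x + b₆ ∈ 𝔽_p[x]` (for a globally minimal `W`
the `bᵢ` are integers, read off as numerators).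
REF1-AUDIT §197 BC7: `natDegree = 3` whenever `(4 : ZMod p) ≠ 0`, i.e. at every odd `p` (`bc7_twoDivCubicModP_natDegree`, `bc7_four_ne_zero`); `.num` reads the integral `bᵢ` of a
globally minimal (hence integral) model ✓. -/
def twoDivCubicModP (W : WeierstrassCurve ℚ) (p : ℕ) : Polynomial (ZMod p) :=
  C (4 : ZMod p) * X ^ 3 + C ((W.b₂.num : ℤ) : ZMod p) * X ^ 2 + C ((2 * W.b₄.num : ℤ) : ZMod p) * X + C ((W.b₆.num : ℤ) : ZMod p)

/-- **The Frobenius-oriented half-discriminant** of a cubic `f` over `𝔽_p`: `δ^φ(f) := (e − e^p)(e − e^{p²})(e^p − e^{p²})` in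
`𝔽_p[x]/(f)`, `e` the class of `x`.  For `f` irreducible this lies in (the image of) `𝔽_p`, is independent of the chosen root, and squares to
`disc` of the monic cubic `f/4`. -/
def frobHalfDisc {p : ℕ} (f : Polynomial (ZMod p)) : AdjoinRoot f :=
  let e : AdjoinRoot f := AdjoinRoot.root f
  (e - e ^ p) * (e - e ^ (p ^ 2)) * (e ^ p - e ^ (p ^ 2))

/-- **ES-30a `ThreeCycleTraceModFour` — THE 3-CYCLE TRACE LEMMA MOD 4 (THEOREM on paper; Lean port target).**  For `W/ℚ` globally minimal,
`p` an odd prime of good reduction at which the `2`-division cubic is irreducible (Frobenius a `3`-cycle on `W[2]`; then `a_p` is odd):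
`a_p(W) ≡ −χ_p(δ^φ) (mod 4)` where `δ^φ ∈ 𝔽_p` is the Frobenius-oriented half-discriminant of the reduced cubic and `χ_p` the quadratic
character.  Equivalently `#W̃(𝔽_p) ≡ p + 1 + χ_p(δ^φ) (mod 4)`.  Brute force: every irreducible cubic over `𝔽_p`, all odd `p ≤ 263`:
376 984 / 376 984 (p30/lemma30a.py); the two classes `(a_p ≡ 1, χ = −1)`, `(a_p ≡ 3, χ = +1)` are equinumerous for each `p`.
Why it might fail: it cannot as stated for `y² = f(x)` (proof above); the port must check that the tree's `frobeniusTrace` is `a_p` at good `p`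
and that `.num` reads the integral `bᵢ` (globally minimal ⟹ integral).  PLACEMENT (REF2-PLACEMENT-v53 §10): COROLLARY OF PRINT —
`⁴√Δ ∈ ℚ(E[4])` functorially (Fukuda–Yoshikawa 2017 Thm. 5.1: a canonical `∧²E[4]`-equivariant bijection `T₄(E[4]) → μ₄⁴√Δ`; Bandini–Paladino
2016 §6) + a finite identity in `GL₂(ℤ/4)` (on 3-cycle lifts `tr g ≡ −s(g) (mod 4)` for the non-`det` quadratic characters `s` of `ρ̄⁻¹(A₃)`,
REF2-checked) + ONE orientation bit for `p ≡ 3 (mod 4)`, which the halving computation above FIXES (not merely calibrates).  Verbatim home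
probably Adelmann, LNM 1761 (2001) §5.5 (acq-14595/14596).  [cite: FukudaYoshikawa2017, Thm. 5.1] [cite: BandiniPaladino2016, §6]
[cite: BekkerZarhin2017, Thm. 2.1 (halving formulas)] [cite: Yelton2015, Thm. 3.1] [cite: Adelmann2001, §5.5]
REF1-AUDIT §197 (D-es-78): **SURVIVES — THEOREM-grade** (paper proof §30.1 re-derived line by line: Cayley–Hamilton cases, norms `N(e − e^p) = −δ^φ`, the Bekker–Zarhin halving
`Q(u, v)` incl. the chord computation, all four `(p mod 4, η)` cases; REF1 second engine: ALL monic irreducible cubics, odd `p ≤ 67`: 422 160/422 160, `(δ^φ)² = disc`, classes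
equinumerous); R197b: rows stay `@[conjecture]` until a Lean proof lands.  REF2-PLACEMENT v53 §10 (ac86d6e19df3a5ec): COROLLARY OF PRINT + a finite identity in `GL₂(ℤ/4)` + ONE
orientation bit — `⁴√Δ ∈ ℚ(E[4])` functorially ([cite: FukudaYoshikawa2017, Thm. 5.1, Cor. 4.5]: canonical `∧²E[4]`-equivariant bijection `T₄(E[4]) ≅ μ₄⁴√Δ`;
[cite: BandiniPaladino2016, §6]) ⟹ `g ↦ g(√d)/√d` is a non-det quadratic character of `ρ̄⁻¹(A₃) ⊂ GL₂(ℤ/4)`; REF2's script `es30a_gl2z4.py`: on the 32 lifts of 3-cycles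
`tr ≡ −s (mod 4)` outright for `det ≡ 1`, and for `det ≡ 3` exactly ONE orientation-matched assignment works — the bit the halving computation FIXES; classical form
`#E(𝔽_p) ≡ p + 1 + χ_p(d) (mod 4)`; verbatim home probably [cite: Adelmann2001, §5.5] (acq-14595); Lean route: `decide` on `GL₂(ZMod 4)` + one cited K₄-structure fact. -/
@[conjecture] def ThreeCycleTraceModFour : Prop :=
  ∀ (W : WeierstrassCurve ℚ) [W.IsElliptic] [W.IsGloballyMinimal] (p : ℕ) [Fact p.Prime],
    p ≠ 2 → W.HasGoodReductionAtPrime p → Irreducible (twoDivCubicModP W p) →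
      ∃ d : ZMod p, algebraMap (ZMod p) (AdjoinRoot (twoDivCubicModP W p)) d = frobHalfDisc (twoDivCubicModP W p) ∧
        W.frobeniusTrace p ≡ -(quadraticChar (ZMod p) d) [ZMOD 4]

/-- **ES-30b `ScalarCharacterLaw` — THE SCALAR CHARACTER OF A MOD-2 CONGRUENCE IS `χ_D`, `D² = Δ_W Δ_{W'}` (THEOREM given ES-30a).**
For `W, W'/ℚ` globally minimal elliptic with irreducible `2`-division cubics and `W ≡ W' (mod 2)`, ONE of the two integers `D = ±√(Δ_W Δ_{W'})`
(namely `D = 16·∏_{i<j}(e_i − e_j)(e'_i − e'_j)` for the Galois-compatible root labelling) satisfies, at every odd prime `p` of common good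
reduction where the cubic of `W` is irreducible mod `p`:  `a_p(W') ≡ (D/p)·a_p(W) (mod 4)`.  (So the mod-`4` representations differ by the
scalar twist `χ_D` plus the `W[2]`-valued class `β`: `W'[4] ≅ W[4] ⊗ (1 + 2(χ_D + β))`.)  Census (BC5 witness): SR29 rows, engine-2 character
measured from `a_p`-congruences at 3-cycle primes vs `|D|`: 217 966 / 217 966 (all rows, on and off the §29 frame); sign of `D` = `sgn σ`
(`σ` the real root bijection) on 107 916 / 107 916 valid rows.  Cheapest falsifier: one congruent pair and one 3-cycle prime for each sign.
Why it might fail: only through a typing slip (`.num` on non-integral models; `frobeniusTrace` at bad `p`) — mathematically it is ES-30a applied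
to both curves at `p` with the common Frobenius orientation.  [cite: LeHungLi2016, Lemma 44–45 (mod-2 congruent pairs)] [cite: BekkerZarhin2017, Thm. 2.1]
REF1-AUDIT §197: **SURVIVES — THEOREM ⟸ ES-30a** (§30.2 re-derived: `Δ_W Δ_{W'} ∈ ℤ²` under `ModTwoCongruent`, equivariant root bijection also in the C₃ case, per-prime form,
UNIQUENESS `ψ = res_F χ_D` by Chebotarev, COROLLARY `ψ_∞ = [σ odd]` derived; REF1 second engine on 700 congruent Cremona pairs, 3-cycle `p ≤ 300`: `ΔΔ′` square 700/700,
exactly one sign of `D` works 700/700; `bc7_selfPair_of_scalarLaw`: the self-pair `W = W'` forces `(D/p) = 1` at 3-cycle primes — consistent).  REF2-PLACEMENT v53 §10: = ES-30a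
twice ✓, KNOWN-TYPE corollary of print; typer: `twoDivCubic` / `ModTwoCongruent` are ES-28's (`F1Sign2/LevelRaisingAtTwo.lean`, opened here — R197b, not re-declared). -/
@[conjecture] def ScalarCharacterLaw : Prop :=
  ∀ (W W' : WeierstrassCurve ℚ) [W.IsElliptic] [W.IsGloballyMinimal] [W'.IsElliptic] [W'.IsGloballyMinimal],
    Irreducible (twoDivCubic W) → ModTwoCongruent W W' →
      ∃ D : ℤ, D ^ 2 = W.Δ.num * W'.Δ.num ∧
        ∀ (p : ℕ) [Fact p.Prime], p ≠ 2 → W.HasGoodReductionAtPrime p → W'.HasGoodReductionAtPrime p →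
          Irreducible (twoDivCubicModP W p) →
            W'.frobeniusTrace p ≡ jacobiSym D p * W.frobeniusTrace p [ZMOD 4]

/-- **ES-30c `SupersingularScalarCharacterCongruence` — AT A COMMON GOOD SUPERSINGULAR 2 THE SCALAR CHARACTER IS UNRAMIFIED: `D ≡ 1 (mod 4)`
(THEOREM given ES-30b and the local lemma L30; = hypothesis (L-ss-iii) of MEMO-es §29 (T8)).**  Same setting, both curves good supersingular at
`2` (`a_2` even): the working `D` of ES-30b is `≡ 1 (mod 4)` (so `χ_D` is unramified at `2`, `d' ≡ 1, 5 (mod 8)`).  L30 (finite 2-adic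
computation, engine `local30.py` in `ℤ₂[ζ₃][∛2]`): the canonical unit `R(W) = −(1+2ζ₃)∏_{i<j}(Y_i − Y_j)/3`, `e_i = ∛2·Y_i/2`, roots labelled by
residues `1, ζ₃, ζ₃²`, is `≡ 1 (mod 4)` on all 8 deciding residue classes (2 048 classes + 6 000 random models: 8 048 / 8 048), whence
`D = −3·R(W)R(W') ≡ 1 (mod 4)`.  Census: g20 SR29 supersingular rows `d' ≡ 1, 5 (mod 8)`: 14 789 / 14 789.  Cheapest falsifier: one good-ss
congruent pair with `D ≡ 3 (mod 4)` (none in 14 789).  Why it might fail: a residue class of good-ss models missed by the parametrisation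
`(a₁ even, a₃ odd)` — none: every good-ss minimal model over `ℤ₂` has `a₁` even, `a₃` odd.  [cite: LeHungLi2016, Thm. 15] [cite: Serre1972, §5 (supersingular 2)]
REF1-AUDIT §197: **SURVIVES — THEOREM ⟸ ES-30b + L30** (L30 precision lemma + §30.8 hand proof re-derived: `x_i`, `Y_i`, `P ≡ P₀ = −3(1+2ζ)`, `R ≡ (1+2ζ)² = −3 ≡ 1 (4)`;
REF1 engine: both-ss pairs `D ≡ 1 (4)` 684/684 (mod 8: 338/346); ord–ord pairs `D ≡ 3 (4)` on 5/16 — witness 53a1 ~ 583b1, `D = −339 889` ⟹ the supersingular binder is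
LOAD-BEARING; the `2 ∣ a₂(W′)` binder is implied (R197c); R197d: «computer-assisted» may be dropped for L30).  REF2-PLACEMENT v53 §12.1: L30 / ES-30c NOT located as a
statement (Kraus 1990 / DD 2008 additive-at-2; Brumer–Kramer 2001 = Fontaine bound `u ≤ 2`; Lozano-Robledo 2016, Freitas–Kraus 2022 no) — KNOWN-TYPE elementary lemma
(Hensel perturbation of `Y³ + 1`), port with its proof; printed neighbour to cite: [cite: LeHungLi2016, Lemma 45] (4) (good ss at 2 ⟹ `E[2]` irreducible `𝔽₂[I]`-module ⟹
unique finite flat model ⟹ `𝓛₂ = H¹_fl(ℤ₂, 𝓔[2])` depends on `E[2]|G_ℚ₂` only = the print form of (L-ss-ii)); this row = hypothesis (L-ss-iii) of MEMO-es §29 (T8), whose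
assembly REF1 §197 passes Honda-free. -/
@[conjecture] def SupersingularScalarCharacterCongruence : Prop :=
  ∀ (W W' : WeierstrassCurve ℚ) [W.IsElliptic] [W.IsGloballyMinimal] [W'.IsElliptic] [W'.IsGloballyMinimal],
    Irreducible (twoDivCubic W) → ModTwoCongruent W W' →
    W.HasGoodReductionAtPrime 2 → (2 : ℤ) ∣ W.frobeniusTrace 2 → W'.HasGoodReductionAtPrime 2 → (2 : ℤ) ∣ W'.frobeniusTrace 2 →
      ∃ D : ℤ, D ^ 2 = W.Δ.num * W'.Δ.num ∧ D ≡ 1 [ZMOD 4] ∧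
        ∀ (p : ℕ) [Fact p.Prime], p ≠ 2 → W.HasGoodReductionAtPrime p → W'.HasGoodReductionAtPrime p →
          Irreducible (twoDivCubicModP W p) →
            W'.frobeniusTrace p ≡ jacobiSym D p * W.frobeniusTrace p [ZMOD 4]

/-- GLUE (sign bookkeeping only): ES-30c refines ES-30b on the supersingular locus.
(REF1 §197: glue CLEAN.) -/
theorem scalarLaw_of_ss (h : SupersingularScalarCharacterCongruence)
    (W W' : WeierstrassCurve ℚ) [W.IsElliptic] [W.IsGloballyMinimal] [W'.IsElliptic] [W'.IsGloballyMinimal]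
    (hirr : Irreducible (twoDivCubic W)) (hc : ModTwoCongruent W W')
    (h2 : W.HasGoodReductionAtPrime 2) (hss : (2 : ℤ) ∣ W.frobeniusTrace 2)
    (h2' : W'.HasGoodReductionAtPrime 2) (hss' : (2 : ℤ) ∣ W'.frobeniusTrace 2) :
    ∃ D : ℤ, D ^ 2 = W.Δ.num * W'.Δ.num ∧
      ∀ (p : ℕ) [Fact p.Prime], p ≠ 2 → W.HasGoodReductionAtPrime p → W'.HasGoodReductionAtPrime p →
        Irreducible (twoDivCubicModP W p) →
          W'.frobeniusTrace p ≡ jacobiSym D p * W.frobeniusTrace p [ZMOD 4] := by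
  obtain ⟨D, hD, -, hlaw⟩ := h W W' hirr hc h2 hss h2' hss'
  exact ⟨D, hD, hlaw⟩

/-- The two candidates `±√(Δ_W Δ_{W'})` give OPPOSITE predictions at a 3-cycle prime (`a_p` odd, `(−D/p) = (−1/p)(D/p)`), so for `p ≡ 3 (4)`
exactly one sign works: the law pins `D` down as soon as one 3-cycle prime `≡ 3 (mod 4)` of good reduction exists (sign bookkeeping). -/
theorem jacobiSym_neg_candidates (D : ℤ) (p : ℕ) [hp : Fact p.Prime] (hp2 : p ≠ 2) (hp3 : p % 4 = 3) :
    jacobiSym (-D) p = -jacobiSym D p := by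
  have hodd : Odd p := hp.out.odd_of_ne_two hp2
  rw [neg_eq_neg_one_mul D, jacobiSym.mul_left, jacobiSym.at_neg_one hodd, ZMod.χ₄_nat_three_mod_four hp3]
  ring

end Summit.BirchSwinnertonDyer.BirchSwinnertonDyer.Theorems.RankOneAtTwoScalarCharacter

end
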